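import Mathlib
import HarnessLib
import Literature.MathematicalPhysics.StatisticalMechanics.StepOperatorBSecondUnifTorusFRD

/-!
# The FULL `ℓ = 2` slot of `B_k` along a LINE of tuning parameters, uniformly in `N`:
# `‖B_{q+2h}K − 2B_{q+h}K + B_qK‖_{k+1,0} ≤ [second-order part] + 2·[first-order part]`
# ([ABKM19] Lemma 12.6 (12.52) with `ℓ = 2`; Lemma 8.7 ⊗ Lemma 8.4 (`ℓ = 2`))

Assembly of the two halves of the second difference of `q ↦ B_k^{(q)}K` along `q, q+h, q+2h` (step data
`abkmStepData L R k` of the kernel families): `B₂ − 2B₁ + B₀ = [B₂ − 2B̄ + B₀] + 2[B̄ − B₁]` with `B̄` the operator of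
the midpoint KERNEL family `½(𝒞_{1+q} + 𝒞_{1+q+2h})`; the genuine second-order part is
`hamNorm_opB_secondDiff_unif_of_torusFRD` (price `27 q_H² (…T e^{2KT}K)² · 4^dκ`, `T = Σ|2h|`) and the first-order
part `hamNorm_opB_mid_sub_unif_of_torusFRD` (price `8 q_H (…) ½(Σ|h|)² K⁽²⁾ · 2^dκ`).  Both are quadratic in `h` and
independent of `N`; the parallelogram form (F4b2) follows by `ParallelogramSecondDiff` in the Banach space
`HamSpace` (not here).

* **`hamNorm_opB_lineSecondDiff_unif_of_torusFRD`**.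

## References
* S. Adams, S. Buchholz, R. Kotecký, S. Müller, arXiv:1910.13564, Lemma 8.7, Lemma 12.6 (12.52)
  [AdamsBuchholzKoteckyMuller2019].
* S. Buchholz, J. Funct. Anal. 275 (2018), Thm 4.5 [Buchholz2016].
-/

noncomputable section

namespace Literature.MathematicalPhysics.StatisticalMechanics.GradientRG

open scoped BigOperators
open Real Set Finset MeasureTheory
open Literature.MathematicalPhysics.StatisticalMechanics.GradientFRD
  (fourierCoeff cExt cExt_of_mem IsElliptic IsUnitSymm InShell iterDiff supNorm conv ellOp isElliptic_one)
open Literature.MathematicalPhysics.StatisticalMechanics.TorusPolymer (IsPolymer numBlocks blockOf boxCorner)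
open Literature.Barriers.CriticalPhenomena.LongRangePhi4.Polymer (IsConn)
open Literature.MathematicalPhysics.QuantumFieldTheory

variable {d M : ℕ} [NeZero M]

section Package

variable {L N Mord R n ñ : ℕ} {θbar lam μ δ₁ δ₀ A𝒫 : ℝ}
    {𝒞 : Matrix (Fin d) (Fin d) ℝ → ℕ → (Fin d → ZMod M) → ℝ} {Mc : ℕ → ℝ}
    {Cα : (Fin d → ℕ) → ℕ → ℝ} {c C : ℝ} {Cℓ : ℕ → ℝ}

set_option maxHeartbeats 3200000 in
/-- **The full `ℓ = 2` slot of `B_k` along a line, uniformly in `N`**: for symmetric `q, h` with `q, q+h, q+2h`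
in the ball `Σ|·| ≤ T₀ ≤ ½`, `k + 1 ≤ N`, a local `C^{r₀}` activity with `‖K‖_k^{(A)} ≤ C`:
`‖B_{q+2h}K − 2B_{q+h}K + B_qK‖_{k+1,0} ≤ [27 q_H²-term (4^dκ)] + 2·[8 q_H ½(Σ|h|)² K⁽²⁾-term (2^dκ)]`, both
`∝ L^d C_{8.7} C (r₀+1) A⁻¹` and independent of `N`. [cite: AdamsBuchholzKoteckyMuller2019, Lemma 8.7 / Lemma 12.6 (12.52)] -/
theorem hamNorm_opB_lineSecondDiff_unif_of_torusFRD
    (hd : 3 ≤ d) (hMord : 1 ≤ Mord) (hMR : Mord ≤ R) (hLodd : Odd L) (hL : 2 ^ (d + 3) + 16 * R ≤ L)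
    (hM : M = L ^ N)
    (hθbar : 0 < θbar) (hlam : 0 < lam) (hn : 2 * Mord ≤ n) (hn2 : 2 ≤ n) (hnñ : n ≤ ñ)
    (hgap : d + 1 ≤ 2 * (ñ - n))
    (hc : 0 < c) (hC1 : 0 ≤ Cℓ 1) (hC2 : 0 ≤ Cℓ 2)
    (hallA : ∀ A : Matrix (Fin d) (Fin d) ℝ, IsElliptic (1 / 2 : ℝ) 2 A →
        (∀ k, 1 ≤ k → k ≤ N + 1 →
          ∑ x : Fin d → ZMod M, 𝒞 A k x = 0 ∧ ∀ x, 𝒞 A k (-x) = 𝒞 A k x) ∧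
        (∀ k, 1 ≤ k → k ≤ N + 1 → ∀ φ : (Fin d → ZMod M) → ℝ, ∑ x, φ x = 0 →
          0 ≤ ∑ x, ∑ y, φ x * 𝒞 A k (x - y) * φ y) ∧
        (∀ φ : (Fin d → ZMod M) → ℝ, ∑ x, φ x = 0 →
          ellOp A (conv (fun x => ∑ k ∈ Finset.Icc 1 (N + 1), 𝒞 A k x) φ) = φ) ∧
        (∀ k, 1 ≤ k → k ≤ N → Mc k ≤ 0 ∧
          ∀ x : Fin d → ZMod M, ((L : ℝ) ^ k) / 2 ≤ (supNorm x : ℝ) →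
            𝒞 A k x = Mc k) ∧
        (∀ k, 1 ≤ k → k ≤ N + 1 → ∀ B : Matrix (Fin d) (Fin d) ℝ, IsUnitSymm B →
          (∃ ε : ℝ, 0 < ε ∧ ∀ x : Fin d → ZMod M,
            ContDiffOn ℝ ⊤ (fun s : ℝ => 𝒞 (A + s • B) k x) (Set.Ioo (-ε) ε)) ∧
          ∀ α : Fin d → ℕ, ∑ i, α i ≤ n → ∀ ℓ : ℕ, ∀ x : Fin d → ZMod M,
            abs (iteratedDeriv ℓ (fun s : ℝ => iterDiff α (𝒞 (A + s • B) k) x) 0)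
              ≤ Cα α ℓ / (L : ℝ) ^ ((k - 1) * (d - 2 + ∑ i, α i))) ∧
        (∀ k, 1 ≤ k → k ≤ N + 1 → ∀ j : ℕ, ∀ κ : Fin d → ZMod M, κ ≠ 0 → InShell L j κ →
          (j < k →
            c / (L : ℝ) ^ (2 * (d + ñ) + 1) * (L : ℝ) ^ (2 * j)
                / (L : ℝ) ^ ((k - j) * (d - 1 + n)) ≤ (fourierCoeff (𝒞 A k) κ).re ∧
            ‖fourierCoeff (𝒞 A k) κ‖
              ≤ C * (L : ℝ) ^ (2 * (d + ñ) + 1) * (L : ℝ) ^ (2 * j)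
                  / (L : ℝ) ^ ((k - j) * (d - 1 + n))) ∧
          (k ≤ j →
            c / (L : ℝ) ^ (2 * (d + ñ) + 1) * (L : ℝ) ^ (2 * k)
                ≤ (fourierCoeff (𝒞 A k) κ).re ∧
            ‖fourierCoeff (𝒞 A k) κ‖ ≤ C * (L : ℝ) ^ (2 * k)) ∧
          ∀ B : Matrix (Fin d) (Fin d) ℝ, IsUnitSymm B → ∀ ℓ : ℕ, 1 ≤ ℓ →
            (j < k →
              ‖iteratedDeriv ℓ (fun s : ℝ => fourierCoeff (𝒞 (A + s • B) k) κ) 0‖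
                ≤ Cℓ ℓ * (L : ℝ) ^ (2 * (d + ñ) + 1) * (L : ℝ) ^ (2 * j)
                    / (L : ℝ) ^ ((k - j) * (d - 1 + ñ))) ∧
            (k ≤ j →
              ‖iteratedDeriv ℓ (fun s : ℝ => fourierCoeff (𝒞 (A + s • B) k) κ) 0‖
                ≤ Cℓ ℓ * (L : ℝ) ^ (2 * k))))
    (hB : AbkmWeightBounds L N Mord R n θbar lam μ δ₁ δ₀ A𝒫 (fun j => 𝒞 1 j)
      (abkmWeightData L N Mord R θbar (schedDelta δ₀ δ₁ N) fun j => 𝒞 1 j))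
    {k : ℕ} (hkN : k + 1 ≤ N) {pT r₀ : ℕ} (hpM : pT + d ≤ Mord) (hr₀ : 3 ≤ r₀) {h A : ℝ} (hh : 0 < h)
    (hA : 1 ≤ A) {ρ : ℝ} (hρ0 : 0 ≤ ρ) (hρ : ρ < θbar)
    {T₀ : ℝ} (hT₀ : T₀ ≤ 1 / 2) (hKT₀ : shellRatioConst c (Cℓ 1) (L : ℝ) d ñ * T₀ ≤ Real.log (1 + ρ))
    {q y : Matrix (Fin d) (Fin d) ℝ} (hq : q.IsSymm) (hh' : y.IsSymm)
    (hqT : ∑ i, ∑ j, |q i j| ≤ T₀) (hqhT : ∑ i, ∑ j, |(q + y) i j| ≤ T₀)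
    (hq2hT : ∑ i, ∑ j, |(q + (2 : ℝ) • y) i j| ≤ T₀)
    {p qH ρ'' : ℝ} (hpq : p.HolderConjugate qH) (hρ''0 : 0 ≤ ρ'') (hρ'' : ρ'' < θbar)
    (hpρ : p * (1 + ρ) ≤ 1 + ρ'')
    {K : Finset (Fin d → ZMod M) → ((Fin d → ZMod M) → ℝ) → ℂ} {C : ℝ} (hC : 0 ≤ C)
    (hK : WeakNormLE (abkmNormParams L N Mord R pT r₀ h θbar A (schedDelta δ₀ δ₁ N) fun j => 𝒞 1 j) k K C)
    (hKd : ∀ X, ContDiff ℝ r₀ (K X))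
    (hKloc : ∀ X, IsPolymer (L ^ k) X → IsConn X →
      IsGaugeLocal ((abkmNormParams L N Mord R pT r₀ h θbar A (schedDelta δ₀ δ₁ N) fun j => 𝒞 1 j).gauge k X)
        (K X)) :
    hamNorm (fieldWt h L d (k + 1)) ((L : ℝ) ^ (k + 1)) (L ^ (d * (k + 1)))
        (opB (abkmStepData L R k fun j => 𝒞 ((1 : Matrix (Fin d) (Fin d) ℝ) + (q + (2 : ℝ) • y)) j) K -
          (2 : ℝ) • opB (abkmStepData L R k fun j => 𝒞 ((1 : Matrix (Fin d) (Fin d) ℝ) + (q + y)) j) K +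
          opB (abkmStepData L R k fun j => 𝒞 ((1 : Matrix (Fin d) (Fin d) ℝ) + q) j) K) ≤
      (L : ℝ) ^ d * (pi2BoundConst d (((2 * R + 2 : ℕ) : ℝ) + ((d / 2 + 1 : ℕ) : ℝ)) *
        (C * ((r₀ + 1) * (27 * qH ^ 2 *
            (Real.sqrt ((3 : ℝ) ^ (d + 1) * (((2 * ((2 * (2 ^ d + R) + 2 * pT + 1) + 1) : ℕ) : ℝ)) ^ d) *
              ((∑ i, ∑ j, |((2 : ℝ) • y) i j|) *
                Real.exp (2 * shellRatioConst c (Cℓ 1) (L : ℝ) d ñ * ∑ i, ∑ j, |((2 : ℝ) • y) i j|) *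
                shellRatioConst c (Cℓ 1) (L : ℝ) d ñ)) ^ 2)) *
          (((2 : ℝ) ^ d) ^ 2 * weightIntConstRho θbar ρ'' (traceConst d Mord R lam (derivSum d n fun θ' _ => Cα θ' 0)) ^ (1 / p)) *
            A⁻¹)) +
      2 * ((L : ℝ) ^ d * (pi2BoundConst d (((2 * R + 2 : ℕ) : ℝ) + ((d / 2 + 1 : ℕ) : ℝ)) *
        (C * ((r₀ + 1) * (8 * qH *
            (Real.sqrt ((3 : ℝ) ^ (d + 1) * (((2 * ((2 * (2 ^ d + R) + 2 * pT + 1) + 1) : ℕ) : ℝ)) ^ d) *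
              (2⁻¹ * (∑ i, ∑ j, |y i j|) ^ 2 * shellRatioConst c (Cℓ 2) (L : ℝ) d ñ)))) *
          ((2 : ℝ) ^ d * weightIntConstRho θbar ρ'' (traceConst d Mord R lam (derivSum d n fun θ' _ => Cα θ' 0)) ^ (1 / p)) *
            A⁻¹))) := by
  have hq2h : (q + (2 : ℝ) • y).IsSymm := hq.add (hh'.smul _)
  have h2 := hamNorm_opB_secondDiff_unif_of_torusFRD hd hMord hMR hLodd hL hM hθbar hlam hn hn2 hnñ hgap hc hC1 hallA
    hB hkN hpM hr₀ hh hA hρ0 hρ hT₀ hKT₀ hq hq2h hqT hq2hT hpq hρ''0 hρ'' hpρ hC hK hKd hKloc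
  rw [add_sub_cancel_left] at h2
  have h1 := hamNorm_opB_mid_sub_unif_of_torusFRD hd hMord hMR hLodd hL hM hθbar hlam hn hn2 hnñ hgap hc hC1 hC2
    hallA hB hkN hpM hr₀ hh hA hρ0 hρ hT₀ hKT₀ hq hh' hqT hqhT hq2hT hpq hρ''0 hρ'' hpρ hC hK hKd hKloc
  -- `B₂ − 2B₁ + B₀ = (B₂ − 2B̄ + B₀) + ((B̄ − B₁) + (B̄ − B₁))`
  set B₂ := opB (abkmStepData L R k fun j => 𝒞 ((1 : Matrix (Fin d) (Fin d) ℝ) + (q + (2 : ℝ) • y)) j) K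
    with hB₂
  set B₁ := opB (abkmStepData L R k fun j => 𝒞 ((1 : Matrix (Fin d) (Fin d) ℝ) + (q + y)) j) K with hB₁
  set B₀ := opB (abkmStepData L R k fun j => 𝒞 ((1 : Matrix (Fin d) (Fin d) ℝ) + q) j) K with hB₀
  set Bm := opB (abkmStepData L R k fun j x => 2⁻¹ * 𝒞 ((1 : Matrix (Fin d) (Fin d) ℝ) + q) j x +
    2⁻¹ * 𝒞 ((1 : Matrix (Fin d) (Fin d) ℝ) + (q + (2 : ℝ) • y)) j x) K with hBm
  have hsplit : B₂ - (2 : ℝ) • B₁ + B₀ = (B₂ - (2 : ℝ) • Bm + B₀) + ((Bm - B₁) + (Bm - B₁)) := by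
    rw [two_smul, two_smul]; abel
  have hL0 : (0 : ℝ) < L := by exact_mod_cast hLodd.pos
  have h𝔥 : 0 ≤ fieldWt h (L : ℝ) d (k + 1) := (fieldWt_pos hh hL0 d (k + 1)).le
  have hRk : (0 : ℝ) ≤ (L : ℝ) ^ (k + 1) := by positivity
  rw [hsplit]
  refine (hamNorm_add_le h𝔥 hRk _ _ _).trans (add_le_add h2 ?_)
  refine (hamNorm_add_le h𝔥 hRk _ _ _).trans ?_
  rw [two_mul]
  exact add_le_add h1 h1

end Package

end Literature.MathematicalPhysics.StatisticalMechanics.GradientRG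

end
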